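import Summits.NavierStokesRegularity.NavierStokesRegularity.Theses.SymmetryModuliCount
import Literature.Analysis.FluidPDE.TypeIAncientMild
import Literature.Analysis.FluidPDE.LocalTypeIReverseSuitable
import Literature.Analysis.FluidPDE.ClassicalTopPointRegularity
-- landed Negative lemma of this crux (witness toolkit of `forcedSymmetry_false_without_H3`), imported so the
-- scratch check sees it: no stub below is over its drift class (every stub quantifies over genuine NS solutions)
import Summits.NavierStokesRegularity.NavierStokesRegularity.Theorems.ForcedSymmetry.Negative.Witness
import HarnessLib.Audit

/-!
# Skeleton line `blow-down-census` for crux `ForcedSymmetry` (stmt-NavierStokesRegularity-4052)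

Route `SymmetryModuliCount`, sub-problem `NavierStokesRegularity` (Clay A, positive side). Crux-plan skeleton
(planner `cruxplan-stmt-NavierStokesRegularity-4052-blow-down-census`, round 1), from the idea card
`Cruxes/ForcedSymmetry/Ideas/blow-down-census.md` (ideator 1; companion card `far-past-energy-ledger` planned as
ONE line with it, as all three triagers asked) and the panel notes `TRIAGE-r1-{1,2,3}.md` (pass ×3).

## The line in one paragraph

The crux says: every `u` in the Type-I KNSS-mild ancient class `A_C` (`IsTypeIAncientMild C u`, definitionally the
four clauses of the decl) has a nonzero infinitesimal similarity symmetry.  The triage panel showed (three independent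
derivations, two machine-checked) that `ForcedSymmetry ⇔ X := TypeIAncientLiouville` — a NONZERO element of `A_C` can
carry no continuous symmetry at all — so every honest line proves `A_C = {0}` and takes the symmetry of the zero field
(`Disproof.lean §4 forcedSymmetry_of_typeIAncientLiouville`).  This line proves `A_C = {0}` by BLOW-DOWN:
1. **Ledger** (`stub_lerayRateEnergy`, card far-past-energy-ledger): Type I + the Oseen identity give Leray-rate energy
   `∫_{B_r(x₀)} |u(t)|² ≤ K r` on every ball (local energy balance started at the parabolic entry time `−4r²`,
   bootstrapped `r³ → r² → r log → r`).
2. **Local-energy class** (`stub_localEnergyClassOfLerayRate`): with the KNSS pressure, `u` is a suitable weak solution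
   on `ℝ³ × ℝ₋` with Albritton–Barker's `𝐈 < ∞` (`A ≤ K`; `C ≤ 2CK` from `|u|³ ≤ C(−t)^{-1/2}|u|²`; `E`, `D` from the
   local energy inequality and the near/far Riesz split at the Leray rate) — the implication A–B 2019 Rem. 3.2 leaves open.
3. **Blow-down** (tree, PROVED: `SuitableCompactness_holds` = A–B Lemma 2.2, `PersistenceOfSingularities_holds` = A–B
   Prop. 2.3, and the zoom API of `LocalTypeIReverse*`): if `u(t,x) ≠ 0`, the blow-downs `c_k u(t₁ + c_k²s, x + c_k y)`
   centred slightly after `t` converge in `L³_loc` along a subsequence to a suitable weak solution `U` on `Q(0,1)` which is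
   SINGULAR at the origin.
4. **The bet** (`stub_blowDownLimitsSelfSimilar`, X-strength, hardest): blow-down limits of elements of `A_C ∩ {𝐈 < ∞}`
   are backward SELF-SIMILAR about the origin — the Navier–Stokes analogue of Giga–Kohn's "Type-I blow-up is
   asymptotically self-similar" (the load-bearing consequence of the card's `UniqueBlowDown`; a monotone/Łojasiewicz
   quantity for the Leray-similarity flow on the local-energy class is the named missing ingredient).
5. **Tsai in the weak local-energy class** (`stub_selfSimilarSuitableRegular`): a backward self-similar suitable weak
   solution in `Q(0,1)` is regular at the origin (profile in `W^{1,2}_loc` ⇒ smooth Leray profile ⇒ `U ≡ 0` by Tsai 1998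
   Thm 2 = tree theorem `tsai_selfsimilar_local_energy_holds`; the constant profiles `c(−t)^{-1/2}` of Tsai Thm 1,
   `q = ∞`, are not in the class: `esssup_t ∫_{B_1}|U|² = ∞` — triage r1-1 sharpening (1)).
Steps 3–5 contradict each other, so `u ≡ 0`; the zero field has every symmetry.  `ForcedSymmetry_of` below is this
composition, sorry-free, concluding the crux decl BY NAME; `typeIAncientLiouville_of_line` records that the same stubs
prove the route target `X` (panel finding: the crux is not a proper sub-problem of `X`).

## Registered stubs (4)

`stub_lerayRateEnergy` (M–L, new) · `stub_localEnergyClassOfLerayRate` (L, known-type) ·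
`stub_blowDownLimitsSelfSimilar` (X-strength, OPEN — hardest) · `stub_selfSimilarSuitableRegular` (M–L, Tsai Thm 2 in the
weak class).  All four are stated over tree declarations only (no local definition), so a `Theorems/` file can restate
each signature verbatim.

## Disproof used

`Cruxes/ForcedSymmetry/Disproof.lean` v3: honours `forcedSymmetry_false_without_H3` — the Oseen identity H3 enters
stub 1 (local energy balance with the pressure `R_iR_j(u_iu_j)`), stub 2 (suitability IS the Navier–Stokes inequality)
and the tree steps 3 (compactness/persistence of NAVIER–STOKES suitable solutions); the drop-H3 witness
`w = e^{t/2}e^{−|x|²}(rot x + x₀ rot0 x)` is not a suitable weak solution and its blow-downs vanish.  Consistent with §2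
(`C ≤ 0`: `A_C ⊆ {0}`, the proof's first branch) and §5 (small `C`: `A_C = {0}` already).  Uses the reading of §4
(`X → ForcedSymmetry`, re-proved here as `simSymmetry_of_vanishes` to keep the file import-light).  The landed
`Theorems/ForcedSymmetry/Negative/Witness.lean` is the witness toolkit only: no stub here is over a drift class, so none
is an instance it refutes; likewise the negatives index (4055 `FiniteTangentModuli`, drift-class linear count) is not
touched — every stub quantifies over genuine (mild, resp. suitable weak) Navier–Stokes solutions.
-/

noncomputable section

set_option linter.dupNamespace false

open MeasureTheory Set Function Filter Topology TopologicalSpace Metric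
open scoped NNReal ENNReal InnerProductSpace RealInnerProductSpace
open Literature.Analysis.FluidPDE
open Summit.NavierStokesRegularity.NavierStokesRegularity.Theses.SymmetryModuliCount

namespace Summit.NavierStokesRegularity.NavierStokesRegularity.Cruxes.ForcedSymmetry.BlowDownCensus

/-! ## The four registered stubs -/

/-- **Stub 1 — the far-past energy LEDGER at Leray's rate** (card `far-past-energy-ledger`, new; A–B 2019 Rem. 3.2
asks exactly whether Type I forces finite scaled energies).  For `u ∈ A_C` the energy in EVERY ball grows at most
linearly in the radius, uniformly in `t < 0` and in the centre: `∫_{B_r(x₀)} |u(t,x)|² dx ≤ K r` (trivial for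
`r ≤ √(−t)` from `|u| ≤ C/√(−t)`; for `r ≥ √(−t)` start the local energy identity on `B_r(x₀)` at `s = −4r²`, where
Type I makes the deposit `O(C²r)`, bound the cubic flux by `|u|³ ≤ C(−s)^{-1/2}|u|²` and the pressure flux by the
near/far Calderón–Zygmund split of `p = R_iR_j(u_iu_j)` (KNSS gauge; tree: `exists_isClassicalNSSolutionOn_Ioo`,
`knss2009_smoothing_holds`), and bootstrap the exponent `3 → 2 → 1+log → 1`).  Size M–L (Lean: L). -/
theorem stub_lerayRateEnergy :
    ∀ (C : ℝ) (u : ℝ → EuclideanSpace ℝ (Fin 3) → EuclideanSpace ℝ (Fin 3)),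
      IsTypeIAncientMild C u →
      ∃ K : ℝ, ∀ t < 0, ∀ (x₀ : EuclideanSpace ℝ (Fin 3)) (r : ℝ), 0 < r →
        ∫ x in ball x₀ r, ‖u t x‖ ^ 2 ≤ K * r := by
  sorry

/-- **Stub 2 — Leray rate + Type I put `u` in Albritton–Barker's local-energy class with `𝐈 < ∞`.**  For `u ∈ A_C`
with Leray-rate energy there are a pressure `p` and a (weak = classical) spatial gradient `G` such that `(u, p)` is a
suitable weak solution of unit-viscosity unforced Navier–Stokes on the slab `(−∞,0) × ℝ³` and
`𝐈(ℝ³ × ℝ₋) = sup_{Q(z,r) ⊆ ℝ³×ℝ₋} (A + C + D + E)(Q(z,r)) < ∞`: `A ≤ K` is the hypothesis; `C(Q_r) ≤ 2CK`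
(`|u|³ ≤ C(−t)^{-1/2}|u|²`, `∫_{−r²}^0 (−t)^{-1/2} = 2r`); `E` from the local energy inequality with a cut-off at scale
`r`; `D` (mean-free!) from the near/far Riesz split of the KNSS pressure at the Leray rate (the sup-norm BMO bound
`C²/(−t)` alone is NOT integrable to the power `3/2` up to `t = 0` — use the energy).  The classical pair on each window
is the tree's `IsTypeIAncientMild.exists_isClassicalNSSolutionOn_Ioo`; suitability of classical pairs and the
Riesz-pressure `L^{3/2}` tools are in tree (`ClassicalSuitable*`, `RieszPressure*`).  Size L (known type). -/
theorem stub_localEnergyClassOfLerayRate :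
    ∀ (C K : ℝ) (u : ℝ → EuclideanSpace ℝ (Fin 3) → EuclideanSpace ℝ (Fin 3)),
      IsTypeIAncientMild C u →
      (∀ t < 0, ∀ (x₀ : EuclideanSpace ℝ (Fin 3)) (r : ℝ), 0 < r →
        ∫ x in ball x₀ r, ‖u t x‖ ^ 2 ≤ K * r) →
      ∃ (p : ℝ → EuclideanSpace ℝ (Fin 3) → ℝ)
        (G : ℝ → EuclideanSpace ℝ (Fin 3) → EuclideanSpace ℝ (Fin 3) →L[ℝ] EuclideanSpace ℝ (Fin 3)),
        IsSuitableWeakSolutionOn (slab (EuclideanSpace ℝ (Fin 3)) (Iio 0) isOpen_Iio) 1 0 u p ∧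
        HasWeakSpatialGradientOn (slab (EuclideanSpace ℝ (Fin 3)) (Iio 0) isOpen_Iio) u G ∧
        typeIBound (Iio (0 : ℝ) ×ˢ (univ : Set (EuclideanSpace ℝ (Fin 3)))) u p G < ⊤ := by
  sorry

/-- **Stub 3 — BLOW-DOWN LIMITS ARE SELF-SIMILAR (the X-strength stub; the bet of the line; hardest).**  For
`u ∈ A_C` in the local-energy class (`𝐈 < ∞`), every `L³_loc` limit `U` of a blow-down sequence
`v_k(s,y) = c_k u(t₁ + c_k² s, x₁ + c_k y)`, `c_k → ∞`, centred at any `z₁ = (t₁, x₁)` with `t₁ < 0`, is BACKWARD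
SELF-SIMILAR about the space–time origin: `μ U(μ²s, μy) = U(s,y)` a.e. on `Q(0,1)` for every `0 < μ < 1`.
The Navier–Stokes analogue of Giga–Kohn 1985/87 ("Type-I blow-up of `u_t = Δu + |u|^{p−1}u` is asymptotically
self-similar", from the monotone weighted energy in similarity variables) and of Huisken's tangent-flow theorem; it is
the load-bearing consequence of the card's `UniqueBlowDown` (full convergence along `c → ∞` ⇒ the limit is invariant
under every further dilation).  OPEN: no monotone or Łojasiewicz-type quantity is known for the Leray-similarity flow on
the local-energy class — that quantity is what a proof must supply (quantitative foothold: Pineau–Vicol 2026 Thm 1.9,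
smallness of the scaling Jacobi field at one time forces regularity).  By the panel finding every line for this crux
carries an `X`-strength stub; this one is vacuous if `X` holds and is REFUTED by a nonzero `λ`-DSS Type-I profile
(Bradshaw–Tsai 2017 OP 5.1) — the route's own kill criterion, nothing weaker. -/
theorem stub_blowDownLimitsSelfSimilar :
    ∀ (C : ℝ) (u : ℝ → EuclideanSpace ℝ (Fin 3) → EuclideanSpace ℝ (Fin 3)),
      IsTypeIAncientMild C u →
      ∀ (p : ℝ → EuclideanSpace ℝ (Fin 3) → ℝ)
        (G : ℝ → EuclideanSpace ℝ (Fin 3) → EuclideanSpace ℝ (Fin 3) →L[ℝ] EuclideanSpace ℝ (Fin 3)),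
        IsSuitableWeakSolutionOn (slab (EuclideanSpace ℝ (Fin 3)) (Iio 0) isOpen_Iio) 1 0 u p →
        HasWeakSpatialGradientOn (slab (EuclideanSpace ℝ (Fin 3)) (Iio 0) isOpen_Iio) u G →
        typeIBound (Iio (0 : ℝ) ×ˢ (univ : Set (EuclideanSpace ℝ (Fin 3)))) u p G < ⊤ →
      ∀ (z₁ : ℝ × EuclideanSpace ℝ (Fin 3)), z₁.1 < 0 →
      ∀ (c : ℕ → ℝ), (∀ k, 0 < c k) → Tendsto c atTop atTop →
      ∀ (U : ℝ → EuclideanSpace ℝ (Fin 3) → EuclideanSpace ℝ (Fin 3)),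
        (∀ R ∈ Ioo (0 : ℝ) 1,
          Tendsto (fun k => eLpNorm (uncurry (c k • stPull (c k ^ 2) (c k) z₁.1 z₁.2 u) - uncurry U) 3
            (volume.restrict (parabolicCylinder R (0 : ℝ × EuclideanSpace ℝ (Fin 3))))) atTop (𝓝 0)) →
        ∀ μ ∈ Ioo (0 : ℝ) 1,
          uncurry (μ • stPull (μ ^ 2) μ 0 (0 : EuclideanSpace ℝ (Fin 3)) U)
            =ᵐ[volume.restrict (parabolicCylinder 1 (0 : ℝ × EuclideanSpace ℝ (Fin 3)))] uncurry U := by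
  sorry

/-- **Stub 4 — Tsai's theorem in the weak local-energy class: a backward self-similar suitable weak solution is
regular at its scaling centre.**  If `(U, P)` is a suitable weak solution (A–B Def. 2.1 class: local energy
inequality, `esssup_t ∫|U|² < ∞`, `∇U ∈ L²`, `P ∈ L^{3/2}`) in every `Q(0,R)`, `R < 1`, and `U` is backward
self-similar about `(0,0)` a.e. on `Q(0,1)`, then the origin is NOT a backward singular point of `U`.  Proof route:
self-similarity gives `U(t,x) = (−t)^{-1/2} f(x/√(−t))` a.e. with `f ∈ W^{1,2}_loc(ℝ³)` (from `E < ∞`) a weak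
solution of Leray's profile system for divergence-free tests; stationary-NS local regularity makes `f` smooth and a
global pressure profile exists (`∇P_f` is determined by `f`; `ℝ³` simply connected), so `(f, P_f)` is an
`IsLerayProfile 1 (1/2)` pair; the energy class on `Q(0,1/2)` transports by self-similarity to Tsai's estimates on
`B₁ × (−1, 0)`; `tsai_selfsimilar_local_energy_holds` (Tsai 1998 Thm 2, PROVED in tree) gives `f = 0`, so `U = 0`
a.e. on `Q(0,1)`, which is bounded.  Tightness: the constant profiles `f ≡ c` (Tsai Thm 1, `q = ∞`, tree
`tsai_selfsimilar_bounded_holds`) give `U = c(−t)^{-1/2}`, singular at the origin — excluded here because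
`esssup_t ∫_{B_R}|U|² = ∞` (triage r1-1, sharpening (1)).  Size M–L. -/
theorem stub_selfSimilarSuitableRegular :
    ∀ (U : ℝ → EuclideanSpace ℝ (Fin 3) → EuclideanSpace ℝ (Fin 3)) (P : ℝ → EuclideanSpace ℝ (Fin 3) → ℝ),
      (∀ R ∈ Ioo (0 : ℝ) 1, IsSuitableWeakSolutionInBall R 0 U P) →
      (∀ μ ∈ Ioo (0 : ℝ) 1,
        uncurry (μ • stPull (μ ^ 2) μ 0 (0 : EuclideanSpace ℝ (Fin 3)) U)
          =ᵐ[volume.restrict (parabolicCylinder 1 (0 : ℝ × EuclideanSpace ℝ (Fin 3)))] uncurry U) →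
      ¬ IsBackwardSingularPoint U 0 := by
  sorry

/-! ## The composition (sorry-free) -/

/-- A field vanishing on `t < 0` has the (translation) symmetry `ξ = (e₀, 0, 0)` — the literal conclusion of the crux
(cf. `Disproof.lean`, `hasSimSymmetry_of_vanishes`). -/
theorem simSymmetry_of_vanishes {u : ℝ → EuclideanSpace ℝ (Fin 3) → EuclideanSpace ℝ (Fin 3)}
    (h : ∀ t < 0, ∀ x, u t x = 0) :
    ∃ (a : EuclideanSpace ℝ (Fin 3)) (σ : ℝ) (A : EuclideanSpace ℝ (Fin 3) →L[ℝ] EuclideanSpace ℝ (Fin 3)),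
      (∀ x, inner ℝ (A x) x = 0) ∧ ¬ (a = 0 ∧ σ = 0 ∧ A = 0) ∧
      ∀ t < 0, ∀ x, fderiv ℝ (u t) x (a + σ • x + A x) + σ • u t x +
        (2 * σ * t) • timeDeriv u t x - A (u t x) = 0 := by
  refine ⟨EuclideanSpace.single 0 1, 0, 0, fun x => by simp, fun hh => ?_, fun t ht x => ?_⟩
  · have h1 : (EuclideanSpace.single (0 : Fin 3) (1 : ℝ) : EuclideanSpace ℝ (Fin 3)) 0 = 1 := by simp
    rw [hh.1] at h1
    simp at h1
  · have hut : u t = fun _ => 0 := funext (h t ht)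
    simp [hut]

/-- **The line proves the route target `X = TypeIAncientLiouville` (stmt-4050)** from the four stubs and the tree's
blow-down machinery: ledger ⇒ local-energy class ⇒ blow-down at a point where `u ≠ 0` ⇒ compact (A–B Lemma 2.2) and
singular at the origin (A–B Prop. 2.3) ⇒ self-similar (stub 3) ⇒ regular at the origin (stub 4): contradiction.
Steps 1–4 of the blow-down are verbatim those of the tree's `localTypeISingularityExists_of_suitable_nontrivial`. -/
theorem typeIAncientLiouville_of_line : TypeIAncientLiouville := by
  intro C u hu t ht x
  have hA : IsTypeIAncientMild C u := isTypeIAncientMild_iff.2 hu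
  by_contra hx
  -- Step 0: the ledger puts `u` in Albritton–Barker's class `𝐈 < ∞`
  obtain ⟨K, hK⟩ := stub_lerayRateEnergy C u hA
  obtain ⟨p, G, hsw, hwg, hI⟩ := stub_localEnergyClassOfLerayRate C K u hA hK
  have hItop : typeIBound (Iio (0 : ℝ) ×ˢ (univ : Set (EuclideanSpace ℝ (Fin 3)))) u p G ≠ ∞ := hI.ne
  -- Step 1: a parabolic ball `Q(z₁, 1)`, `t₁ < 0`, containing `(t, x)`, on which `‖u‖_∞ ≠ 0`
  set δ : ℝ := min (-t / 2) (1 / 2) with hδ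
  have hδpos : 0 < δ := lt_min (by linarith) (by norm_num)
  have hδle : δ ≤ 1 / 2 := min_le_right _ _
  have hδle' : δ ≤ -t / 2 := min_le_left _ _
  have hz₁ : ((t + δ, x) : ℝ × EuclideanSpace ℝ (Fin 3)).1 < 0 := by
    show t + δ < 0
    linarith
  have hmem : ((t, x) : ℝ × EuclideanSpace ℝ (Fin 3)) ∈
      parabolicCylinder 1 ((t + δ, x) : ℝ × EuclideanSpace ℝ (Fin 3)) := by
    rw [mem_parabolicCylinder]
    refine ⟨⟨?_, ?_⟩, ?_⟩
    · show t + δ - 1 ^ 2 < t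
      linarith
    · show t < t + δ
      linarith
    · show dist x x < 1
      rw [dist_self]
      exact one_pos
  have hN : eLpNorm (uncurry u) ∞
      (volume.restrict (parabolicCylinder 1 ((t + δ, x) : ℝ × EuclideanSpace ℝ (Fin 3)))) ≠ 0 := by
    intro h0
    have hcont : ContinuousOn (uncurry u)
        (parabolicCylinder 1 ((t + δ, x) : ℝ × EuclideanSpace ℝ (Fin 3))) :=
      hA.continuousOn_uncurry.mono (parabolicCylinder_subset_lowerHalf hz₁.le 1)
    have hle := enorm_le_eLpNorm_top_restrict_of_continuousOn (μ := volume)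
      (isOpen_parabolicCylinder 1 ((t + δ, x) : ℝ × EuclideanSpace ℝ (Fin 3))) hcont hmem
    rw [h0, nonpos_iff_eq_zero, uncurry_apply_pair, enorm_eq_zero] at hle
    exact hx hle
  -- Step 2: the blow-down sequence centred at `z₁` (A–B §3)
  set c : ℕ → ℝ := fun k => (k : ℝ) + 1 with hc
  have hcpos : ∀ k, 0 < c k := fun k => by positivity
  have hctop : Tendsto c atTop atTop :=
    tendsto_atTop_add_const_right _ _ tendsto_natCast_atTop_atTop
  set v : ℕ → ℝ → EuclideanSpace ℝ (Fin 3) → EuclideanSpace ℝ (Fin 3) :=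
    fun k => c k • stPull (c k ^ 2) (c k) (t + δ) x u with hv
  set qf : ℕ → ℝ → EuclideanSpace ℝ (Fin 3) → ℝ :=
    fun k => c k ^ 2 • stPull (c k ^ 2) (c k) (t + δ) x p with hqf
  set q : ℕ → ℝ → EuclideanSpace ℝ (Fin 3) → ℝ :=
    fun k s y => qf k s y - ⨍ y' in ball (0 : EuclideanSpace ℝ (Fin 3)) 1, qf k s y' with hq
  have hball : ∀ k, IsSuitableWeakSolutionInBall 1 0 (v k) (q k) := fun k =>
    isSuitableWeakSolutionInBall_zoom hsw hwg hItop (hcpos k) hz₁ x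
  have hsup : (⨆ k, eLpNorm (uncurry (v k)) 3
        (volume.restrict (parabolicCylinder 1 (0 : ℝ × EuclideanSpace ℝ (Fin 3)))) +
      eLpNorm (uncurry (q k)) (3 / 2)
        (volume.restrict (parabolicCylinder 1 (0 : ℝ × EuclideanSpace ℝ (Fin 3))))) < ∞ := by
    refine lt_of_le_of_lt (iSup_le fun k => add_le_add
      (eLpNorm_zoom_velocity_le (hcpos k) hz₁.le x p G)
      (eLpNorm_zoom_pressure_le (hcpos k) hz₁.le x u G)) ?_
    exact ENNReal.add_lt_top.2 ⟨ENNReal.rpow_lt_top_of_nonneg (by norm_num) hItop,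
      ENNReal.rpow_lt_top_of_nonneg (by norm_num) hItop⟩
  -- Step 3: compactness (A–B Lemma 2.2, tree theorem)
  obtain ⟨U, P, σ, hσ, hlim⟩ := SuitableCompactness_holds v q hball hsup
  -- Step 4: persistence of the singularity at the origin (A–B Prop. 2.3, tree theorem)
  have hsing : IsBackwardSingularPoint U 0 := by
    refine PersistenceOfSingularities_holds (fun j => v (σ j)) (fun j => q (σ j)) U P
      (fun j => hball (σ j)) ?_ ?_ ?_
    · refine lt_of_le_of_lt (iSup_le fun j => ?_) hsup
      exact le_iSup (fun k => eLpNorm (uncurry (v k)) 3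
        (volume.restrict (parabolicCylinder 1 (0 : ℝ × EuclideanSpace ℝ (Fin 3)))) +
        eLpNorm (uncurry (q k)) (3 / 2)
        (volume.restrict (parabolicCylinder 1 (0 : ℝ × EuclideanSpace ℝ (Fin 3))))) (σ j)
    · intro R hR
      obtain ⟨h1, -, h3, h4⟩ := hlim R hR
      exact ⟨h1, h3, h4⟩
    · intro R hR
      exact (tendsto_eLpNorm_top_nsZoom_atTop (u := u) (z₁ := ((t + δ, x) : ℝ × EuclideanSpace ℝ (Fin 3)))
        (fun j => hcpos (σ j)) (hctop.comp hσ.tendsto_atTop) hN hR.1).limsup_eq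
  -- Step 5: the blow-down limit is backward self-similar about the origin (stub 3)
  have hss : ∀ μ ∈ Ioo (0 : ℝ) 1,
      uncurry (μ • stPull (μ ^ 2) μ 0 (0 : EuclideanSpace ℝ (Fin 3)) U)
        =ᵐ[volume.restrict (parabolicCylinder 1 (0 : ℝ × EuclideanSpace ℝ (Fin 3)))] uncurry U :=
    stub_blowDownLimitsSelfSimilar C u hA p G hsw hwg hI (t + δ, x) hz₁ (fun j => c (σ j))
      (fun j => hcpos (σ j)) (hctop.comp hσ.tendsto_atTop) U (fun R hR => (hlim R hR).2.2.1)
  -- Step 6: a self-similar suitable weak solution is regular at the origin (stub 4): contradiction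
  exact stub_selfSimilarSuitableRegular U P (fun R hR => (hlim R hR).1) hss hsing

/-- **The skeleton concludes the crux BY NAME**: `ForcedSymmetry` (route `SymmetryModuliCount`,
stmt-NavierStokesRegularity-4052) from the four registered stubs — `A_C = {0}` by the blow-down line, and the zero
field is symmetric. -/
theorem ForcedSymmetry_of : ForcedSymmetry := by
  intro C u hu
  exact simSymmetry_of_vanishes (typeIAncientLiouville_of_line C u hu)

end Summit.NavierStokesRegularity.NavierStokesRegularity.Cruxes.ForcedSymmetry.BlowDownCensus

end
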